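import Literature.Computability.FineGrained.KSatExponentGapProofs
import Literature.Computability.FineGrained.SparsificationAlgorithm
import HarnessLib

/-!
# `(s_k)` increases infinitely often under ETH: reduction to the renaming machine alone

Family `fine-grained` (trunk T-CPLX-FINE); sibling of `FineGrainedWave0Proofs.lean` and
`KSatExponentGapProofs.lean` (D-0014). The named fact
`Literature.Computability.FineGrained.ETH.frequently_satExponent_lt` (**fine-grained.S04**,
consequence: "`s_k` is increasing infinitely often assuming ETH", Impagliazzo–Paturi, JCSS 62
(2001), abstract and p. 369; quoted in Fomin–Kratsch 2010, p. 178) is derived in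
`FineGrainedWave0Proofs.lean` from the brute-force bound `kSATInExpTime_one` and Theorem 3
`satExponent_le_satExponentLimit` (`ETH.frequently_satExponent_lt_of`); Theorem 3 is assembled in
`KSatExponentGap(Proofs).lean` and `IPLemma2Assembly.lean` from machine facts of which all but one
are now theorems of the tree:

* `kSATInExpTime_one_holds` (`SATBruteForceMachine.lean`),
* `lightKSAT_exhaustiveSearch_holds` (`LightSatMachine.lean`),
* `Compaction.kCNF_compact_computable_holds` (`CompactionMachine.lean`),
* `sparsification_holds` (`SparsificationAlgorithm.lean`, **fine-grained.S05**).

This file plugs the last of these in (the two proof files above do not import the sparsifier)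
and records the resulting one-hypothesis reductions: Lemma 2 (`impagliazzoPaturi_lemma2`),
Theorem 3 (`satExponent_le_satExponentLimit`) and the consequence
(`ETH.frequently_satExponent_lt`) each follow from the single remaining machine fact
`ipRename_reduceList_computable` (`IPLemma2Assembly.lean`: the renaming reduction
`IPRename.reduceList` is computable within its output size; the "Moreover" sentence of Lemma 2,
p. 373), whose machine is under construction in `IPRename*.lean`. No new facts are introduced.

## References

* R. Impagliazzo, R. Paturi, *On the complexity of k-SAT*, J. Comput. System Sci. 62 (2001)
  367–375, doi:10.1006/jcss.2000.1727: abstract and p. 369 (the consequence), Lemma 2 (p. 373),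
  Theorem 3 (p. 374). [key `ImpagliazzoPaturiJCSS2001`; not held, acquisition requested]
* F. V. Fomin, D. Kratsch, *Exact Exponential Algorithms*, Springer 2010, p. 178: "Impagliazzo and
  Paturi show that `s_k` increases infinitely often assuming ETH." [key `FominKratsch2010`; held]
-/

namespace Literature.Computability.FineGrained

/-- **Impagliazzo–Paturi 2001, Lemma 2, from the renaming machine alone**: with the
sparsification algorithm a theorem (`sparsification_holds`) and the compaction machine a theorem
(`Compaction.kCNF_compact_computable_holds`, used inside `impagliazzoPaturi_lemma2_of_machines`),
the named fact `impagliazzoPaturi_lemma2` follows from `ipRename_reduceList_computable`.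
[cite: ImpagliazzoPaturiJCSS2001, Lemma 2 (p. 373)] -/
theorem impagliazzoPaturi_lemma2_of_ipRename (h : ipRename_reduceList_computable) :
    impagliazzoPaturi_lemma2 :=
  impagliazzoPaturi_lemma2_of_machines sparsification_holds h

/-- **Impagliazzo–Paturi 2001, Theorem 3 (`s_k ≤ (1 - d/k) s_∞`), from the renaming machine
alone.** [cite: ImpagliazzoPaturiJCSS2001, Theorem 3 (p. 374)] -/
theorem satExponent_le_satExponentLimit_of_ipRename (h : ipRename_reduceList_computable) :
    satExponent_le_satExponentLimit :=
  satExponent_le_satExponentLimit_of_two_machines sparsification_holds h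

/-- **fine-grained.S04, consequence, from the renaming machine alone**: assuming ETH, `(s_k)`
increases infinitely often (the named fact `ETH.frequently_satExponent_lt`), granted
`ipRename_reduceList_computable`; the brute-force bound is the theorem `kSATInExpTime_one_holds`.
[cite: ImpagliazzoPaturiJCSS2001, abstract and p. 369 (consequence of Theorem 3)] -/
theorem ETH.frequently_satExponent_lt_of_ipRename (h : ipRename_reduceList_computable) :
    ETH.frequently_satExponent_lt :=
  ETH.frequently_satExponent_lt_of kSATInExpTime_one_holds
    (satExponent_le_satExponentLimit_of_ipRename h)

end Literature.Computability.FineGrained
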